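import Mathlib
import HarnessLib
import Summits.HubbardSuperconductivity.HubbardSuperconductivity.Theorems.KLProgrammeKLRegimeSplitGlue
import Summits.HubbardSuperconductivity.HubbardSuperconductivity.Theorems.KLProgrammeKLRegimeSplitBundleV6

/-!
# Route `KLProgramme` — the K3-NAMED glue of the split at the V6 predicate bundle `klPredsV6`, restaged children
# (stmt-HubbardSuperconductivity-19937; DOWNSTREAM of the route file; cell gate-hubbard-kl, filer p1b g3)

One line: the restaged generic glue (`k3_twoPointLimit_of_childrenP2`, p2 `…SplitGenericV2`) at the V6 bundle `klPredsV6`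
(`…SplitBundleV6`), composed with the route's S0 theorem `MuOfDopingWindow_holds` — the closer of the glue item of the K3 split
whose children of record are `EngineP2 klPredsV6 klWindowC`, `BetaSplitP klPredsV6 klWindowC`, `CountertermP2 klPredsV6 klWindowC`,
`TwoPointAssemblyP klPredsV6 klWindowC`.  Nothing else is asserted.
-/

noncomputable section

namespace Summit.HubbardSuperconductivity.HubbardSuperconductivity.Theorems.KLRegimeSplit

set_option linter.dupNamespace false -- summit = problem name (single-conjunct summit), D-0017

open Summit.HubbardSuperconductivity.HubbardSuperconductivity.Theses.KLProgramme

/-- **The K3-named glue at the V6 bundle (restaged children)**: the four children at `klPredsV6` imply crux K3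
`KLRegimeTwoPointLimit` BY NAME (strong induction on the scale index in the order `G → P → R → Q → (c₀, c₁) → U₀` + S0
`MuOfDopingWindow_holds`, all inside `k3_twoPointLimit_of_childrenP2`). -/
theorem KLRegimeInductionV6 :
    EngineP2 klPredsV6 klWindowC → BetaSplitP klPredsV6 klWindowC → CountertermP2 klPredsV6 klWindowC →
      TwoPointAssemblyP klPredsV6 klWindowC →
        Summit.HubbardSuperconductivity.HubbardSuperconductivity.Theses.KLProgramme.KLRegimeTwoPointLimit :=
  fun h₃ h₁ h₂ h₄ => k3_twoPointLimit_of_childrenP2 h₃ h₁ h₂ h₄ MuOfDopingWindow_holds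

end Summit.HubbardSuperconductivity.HubbardSuperconductivity.Theorems.KLRegimeSplit

end
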